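import Summits.QuantumFields.YangMills.Theorems.ColdStartUniversalityLatticeLangevinCasimirTwo
import Summits.QuantumFields.YangMills.Theorems.ColdStartUniversalityLatticeLangevinGradientDriftCore
import HarnessLib

/-!
# Route `ColdStartUniversality` (fixed-cut-off package, Bakry–Émery side): the `𝔰𝔲(2)` BRACKET ALGEBRA of the noise frame —
# closure, antisymmetric structure constants, and the Ricci identity `Σ_{μν} ℓ([P_μ,P_ν])² = 4 Σ_ν ℓ(P_ν)²`

Helper file (seat `ym-line-csu-p1`, g25; `--supports stmt-QuantumFields-24809`).  The noise directions of the SU(2) lattice Langevin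
dynamics of Shen–Zhu–Zhu are `P_ν = 𝐩(E_ν)`, `ν ∈ NoiseIdx 2` (a Parseval frame of `(𝔰𝔲(2), Re tr(X Yᴴ))`).  For Bochner's formula along
the right-invariant frame `y ↦ √2 P_ν Q_e` (sequel file) one needs three algebraic facts about this frame, proved here from the explicit basis
`v_a = iσ_a` of `…CasimirTwo`:
* `bracket_lieProj_mem_lieAlg`, `sum_hsForm_smul_lieProj_of_mem` — `[P_μ, P_ν] ∈ 𝔰𝔲(2)` and Parseval `Σ_κ ⟨X, P_κ⟩ P_κ = X` on `𝔰𝔲(2)`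
  (closure of the frame under brackets);
* ★ `hsForm_bracket_antisymm` — `⟨[A,B], C⟩ = −⟨[C,B], A⟩` for skew-Hermitian `A, C` (total antisymmetry of the structure constants
  `⟨[P_μ,P_ν], P_κ⟩`; trace cyclicity);
* ★★ `sum_sum_sq_apply_bracket_lieProj` — the RICCI IDENTITY of the frame: for every real-linear functional `ℓ` on `M₂(ℂ)`,
  `Σ_μ Σ_ν ℓ(P_μP_ν − P_νP_μ)² = 4 Σ_ν ℓ(P_ν)²` (`Ric = N/2 = 1` for the Hilbert–Schmidt metric on `SU(2)`, Shen–Zhu–Zhu (4.8), read on a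
  Parseval frame: `¼ Σ ‖ad‖²`); proof: `P_ν = Σ_a ½⟨E_ν, v_a⟩ v_a`, Gram matrix `CᵀC = ½·1`, `[v_a, v_b] = −2 ε_{abc} v_c`.
THEOREMS ONLY, no definition, no sorry.  HONEST FRAMING: finite-dimensional algebra; nothing K-uniform; the YM mass gap is NOT proved.
-/

set_option autoImplicit false

noncomputable section

namespace Summit.QuantumFields.YangMills.Theorems.ColdStartUniversality

open Matrix Complex Finset
open scoped ComplexConjugate BigOperators Matrix
open Literature.MathematicalPhysics.QuantumFieldTheory
open Literature.MathematicalPhysics.QuantumLattice (fundamentalRep fundamentalLatticeRep)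

/-! ## §1. Closure of the frame under brackets; Parseval on `𝔰𝔲(2)` -/

/-- The commutator of two noise directions `P_μ = 𝐩(E_μ)` lies in `𝔰𝔲(2)` (skew-Hermitian and traceless). [folklore] -/
theorem bracket_lieProj_mem_lieAlg (μ ν : NoiseIdx (fundamentalLatticeRep 2).N) :
    (fundamentalLatticeRep 2).lieProj (noiseDir μ) * (fundamentalLatticeRep 2).lieProj (noiseDir ν) -
        (fundamentalLatticeRep 2).lieProj (noiseDir ν) * (fundamentalLatticeRep 2).lieProj (noiseDir μ) ∈
      (fundamentalLatticeRep 2).lieAlg := by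
  set A := (fundamentalLatticeRep 2).lieProj (noiseDir μ)
  set B := (fundamentalLatticeRep 2).lieProj (noiseDir ν)
  have hA : star A = -A := (fundamentalLatticeRep 2).star_lieProj _
  have hB : star B = -B := (fundamentalLatticeRep 2).star_lieProj _
  refine mem_lieAlg_two_of_star_eq_neg ?_ ?_
  · rw [star_sub, star_mul, star_mul, hA, hB]
    simp only [neg_mul_neg]
    abel
  · rw [Matrix.trace_sub, Matrix.trace_mul_comm, sub_self]

/-- **Parseval on `𝔰𝔲(2)` along the noise frame**: `Σ_κ ⟨X, P_κ⟩ P_κ = X` for `X ∈ 𝔰𝔲(2)`. [folklore] -/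
theorem sum_hsForm_smul_lieProj_of_mem {X : Matrix (Fin (fundamentalLatticeRep 2).N) (Fin (fundamentalLatticeRep 2).N) ℂ}
    (hX : X ∈ (fundamentalLatticeRep 2).lieAlg) :
    ∑ κ : NoiseIdx (fundamentalLatticeRep 2).N, hsForm (fundamentalLatticeRep 2).N X
        ((fundamentalLatticeRep 2).lieProj (noiseDir κ)) • (fundamentalLatticeRep 2).lieProj (noiseDir κ) = X := by
  rw [sum_hsForm_lieProj_smul, (fundamentalLatticeRep 2).lieProj_of_mem hX, (fundamentalLatticeRep 2).lieProj_of_mem hX]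

/-! ## §2. Antisymmetry of the structure constants -/

/-- ★ **`⟨[A,B], C⟩ = −⟨[C,B], A⟩`** for skew-Hermitian `A` and `C` (`⟨X,Y⟩ = Re tr(X Yᴴ)`): the structure constants
`⟨[P_μ,P_ν], P_κ⟩` of the frame are antisymmetric under `μ ↔ κ` (trace cyclicity). [folklore] -/
theorem hsForm_bracket_antisymm {N : ℕ} {A C : Matrix (Fin N) (Fin N) ℂ} (hA : Aᴴ = -A) (hC : Cᴴ = -C)
    (B : Matrix (Fin N) (Fin N) ℂ) :
    hsForm N (A * B - B * A) C = -hsForm N (C * B - B * C) A := by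
  simp only [hsForm_apply, hA, hC, Matrix.mul_neg, Matrix.trace_neg, Matrix.sub_mul, Matrix.trace_sub,
    Complex.neg_re, Complex.sub_re]
  have h1 : (C * B * A).trace = (B * A * C).trace := by rw [Matrix.mul_assoc, Matrix.trace_mul_comm]
  have h2 : (B * C * A).trace = (A * B * C).trace := by rw [Matrix.trace_mul_comm, ← Matrix.mul_assoc]
  rw [h1, h2]
  ring

/-! ## §3. The Ricci identity of the frame -/

/-- Products of the basis `v_a = iσ_a`: the six commutators `[v_a, v_b] = -2 ε_{abc} v_c`. [folklore] -/
theorem su2Dir_bracket :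
    let v : Fin 3 → Matrix (Fin 2) (Fin 2) ℂ := ![!![0, Complex.I; Complex.I, 0], !![0, 1; -1, 0], !![Complex.I, 0; 0, -Complex.I]]
    v 0 * v 1 - v 1 * v 0 = -(2 : ℂ) • v 2 ∧ v 1 * v 2 - v 2 * v 1 = -(2 : ℂ) • v 0 ∧ v 2 * v 0 - v 0 * v 2 = -(2 : ℂ) • v 1 := by
  refine ⟨?_, ?_, ?_⟩ <;>
  · ext i j
    fin_cases i <;> fin_cases j <;> simp <;> ring

/-- Expansion of a noise direction in the basis: `P_ν = Σ_a ½⟨E_ν, v_a⟩ v_a`. [folklore] -/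
theorem lieProj_noiseDir_eq_sum_su2Dir (ν : NoiseIdx (fundamentalLatticeRep 2).N) :
    (fundamentalLatticeRep 2).lieProj (noiseDir ν) =
      ∑ a : Fin 3, ((hsForm (fundamentalLatticeRep 2).N (noiseDir ν) ((![!![0, Complex.I; Complex.I, 0], !![0, 1; -1, 0],
        !![Complex.I, 0; 0, -Complex.I]] : Fin 3 → Matrix (Fin 2) (Fin 2) ℂ) a) / 2 : ℝ) : ℂ) •
        (![!![0, Complex.I; Complex.I, 0], !![0, 1; -1, 0], !![Complex.I, 0; 0, -Complex.I]] : Fin 3 → Matrix (Fin 2) (Fin 2) ℂ) a := by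
  set v : Fin 3 → Matrix (Fin (fundamentalLatticeRep 2).N) (Fin (fundamentalLatticeRep 2).N) ℂ := fun a => (![!![0,
        Complex.I; Complex.I, 0], !![0, 1; -1, 0], !![Complex.I, 0; 0, -Complex.I]] : Fin 3 → Matrix (Fin 2) (Fin 2) ℂ) a with hv
  have hvskew : ∀ a, star (v a) = -v a := fun a => star_su2Dir a
  have hvtr : ∀ a, (v a).trace = 0 := fun a => trace_su2Dir a
  have hvmem : ∀ a, v a ∈ (fundamentalLatticeRep 2).lieAlg := fun a => mem_lieAlg_two_of_star_eq_neg (hvskew a) (hvtr a)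
  have h := eq_sum_hsForm_su2Dir_smul ((fundamentalLatticeRep 2).star_lieProj (noiseDir ν))
    (trace_eq_zero_of_mem_lieAlg_two ((fundamentalLatticeRep 2).lieProj_mem (noiseDir ν)))
  have hcoef : ∀ a, hsForm (fundamentalLatticeRep 2).N ((fundamentalLatticeRep 2).lieProj (noiseDir ν)) (v a) =
      hsForm (fundamentalLatticeRep 2).N (noiseDir ν) (v a) := by
    intro a
    rw [hsForm_lieProj_comm, (fundamentalLatticeRep 2).lieProj_of_mem (hvmem a)]
  refine h.trans (Finset.sum_congr rfl fun a _ => ?_)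
  rw [← hcoef a]
  rfl

/-- **Gram identity of the coefficients**: `Σ_ν ½⟨E_ν, v_a⟩ · ½⟨E_ν, v_b⟩ = ½ δ_{ab}` (Parseval for `(E_ν)` and
`⟨v_a, v_b⟩ = 2δ_{ab}`). [folklore] -/
theorem sum_coef_su2Dir_mul (a b : Fin 3) :
    ∑ ν : NoiseIdx (fundamentalLatticeRep 2).N, hsForm (fundamentalLatticeRep 2).N (noiseDir ν)
        ((![!![0, Complex.I; Complex.I, 0], !![0, 1; -1, 0], !![Complex.I, 0; 0, -Complex.I]] :
          Fin 3 → Matrix (Fin 2) (Fin 2) ℂ) a) / 2 *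
      (hsForm (fundamentalLatticeRep 2).N (noiseDir ν) ((![!![0, Complex.I; Complex.I, 0], !![0, 1; -1, 0],
        !![Complex.I, 0; 0, -Complex.I]] : Fin 3 → Matrix (Fin 2) (Fin 2) ℂ) b) / 2) = if a = b then 1 / 2 else 0 := by
  set v : Fin 3 → Matrix (Fin (fundamentalLatticeRep 2).N) (Fin (fundamentalLatticeRep 2).N) ℂ := fun a =>
    (![!![0, Complex.I; Complex.I, 0], !![0, 1; -1, 0], !![Complex.I, 0; 0, -Complex.I]] : Fin 3 → Matrix (Fin 2) (Fin 2) ℂ) a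
    with hv
  have hvv : hsForm (fundamentalLatticeRep 2).N (v a) (v b) = if a = b then 2 else 0 := hsForm_su2Dir a b
  change ∑ ν : NoiseIdx (fundamentalLatticeRep 2).N, hsForm (fundamentalLatticeRep 2).N (noiseDir ν) (v a) / 2 *
      (hsForm (fundamentalLatticeRep 2).N (noiseDir ν) (v b) / 2) = _
  have h : ∑ ν : NoiseIdx (fundamentalLatticeRep 2).N, hsForm (fundamentalLatticeRep 2).N (noiseDir ν) (v a) / 2 *
      (hsForm (fundamentalLatticeRep 2).N (noiseDir ν) (v b) / 2) =
      (∑ ν : NoiseIdx (fundamentalLatticeRep 2).N, hsForm (fundamentalLatticeRep 2).N (v a) (noiseDir ν) *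
        hsForm (fundamentalLatticeRep 2).N (v b) (noiseDir ν)) / 4 := by
    rw [Finset.sum_div]
    refine Finset.sum_congr rfl fun ν _ => ?_
    rw [hsForm_comm (noiseDir ν) (v a), hsForm_comm (noiseDir ν) (v b)]
    ring
  rw [h, sum_hsForm_noiseDir_mul, hvv]
  split_ifs <;> norm_num

/-- ★★ **Ricci identity of the noise frame of `𝔰𝔲(2)`**: for every real-linear functional `ℓ` on `M₂(ℂ)`,
`Σ_μ Σ_ν ℓ(P_μP_ν − P_νP_μ)² = 4 Σ_ν ℓ(P_ν)²`, `P_ν = 𝐩(E_ν)`.  (For an orthonormal basis `Y_a` of `(𝔰𝔲(N), Re tr XYᴴ)` this is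
`Σ_{ab} ℓ([Y_a,Y_b])² = 4·(N/2)·Σ_a ℓ(Y_a)²`, the Ricci curvature `N/2` of Shen–Zhu–Zhu (4.8); here `N = 2` and the Parseval frame `P_ν`
gives the same sums.) [cite: ShenZhuZhu2022, §4 (4.8)] -/
theorem sum_sum_sq_apply_bracket_lieProj
    (ℓ : Matrix (Fin (fundamentalLatticeRep 2).N) (Fin (fundamentalLatticeRep 2).N) ℂ →ₗ[ℝ] ℝ) :
    ∑ μ : NoiseIdx (fundamentalLatticeRep 2).N, ∑ ν : NoiseIdx (fundamentalLatticeRep 2).N,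
      (ℓ ((fundamentalLatticeRep 2).lieProj (noiseDir μ) * (fundamentalLatticeRep 2).lieProj (noiseDir ν) -
        (fundamentalLatticeRep 2).lieProj (noiseDir ν) * (fundamentalLatticeRep 2).lieProj (noiseDir μ))) ^ 2 =
      4 * ∑ ν : NoiseIdx (fundamentalLatticeRep 2).N, (ℓ ((fundamentalLatticeRep 2).lieProj (noiseDir ν))) ^ 2 := by
  set v : Fin 3 → Matrix (Fin (fundamentalLatticeRep 2).N) (Fin (fundamentalLatticeRep 2).N) ℂ := fun a =>
    (![!![0, Complex.I; Complex.I, 0], !![0, 1; -1, 0], !![Complex.I, 0; 0, -Complex.I]] : Fin 3 → Matrix (Fin 2) (Fin 2) ℂ) a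
    with hv
  -- coefficient matrix `C ν a = ½⟨E_ν, v_a⟩`
  set C : NoiseIdx (fundamentalLatticeRep 2).N → Fin 3 → ℝ := fun ν a =>
    hsForm (fundamentalLatticeRep 2).N (noiseDir ν) (v a) / 2 with hC
  set Cm : Matrix (NoiseIdx (fundamentalLatticeRep 2).N) (Fin 3) ℝ := Matrix.of C with hCm
  have hP : ∀ ν : NoiseIdx (fundamentalLatticeRep 2).N,
      (fundamentalLatticeRep 2).lieProj (noiseDir ν) = ∑ a : Fin 3, ((C ν a : ℝ) : ℂ) • v a :=
    fun ν => lieProj_noiseDir_eq_sum_su2Dir ν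
  have hGram : Cmᵀ * Cm = (1 / 2 : ℝ) • (1 : Matrix (Fin 3) (Fin 3) ℝ) := by
    ext a b
    rw [Matrix.mul_apply, Matrix.smul_apply, Matrix.one_apply]
    simp only [Matrix.transpose_apply, hCm, Matrix.of_apply, hC]
    rw [sum_coef_su2Dir_mul a b]
    split_ifs <;> simp
  -- real scalars through `ℓ`
  have hℓ : ∀ (r : ℝ) (M : Matrix (Fin (fundamentalLatticeRep 2).N) (Fin (fundamentalLatticeRep 2).N) ℂ),
      ℓ (((r : ℝ) : ℂ) • M) = r * ℓ M := by
    intro r M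
    rw [Complex.coe_smul, map_smul, smul_eq_mul]
  -- the bracket matrix `X a b = ℓ([v_a, v_b])` and the vector `w a = ℓ(v_a)`
  set X : Fin 3 → Fin 3 → ℝ := fun a b => ℓ (v a * v b - v b * v a) with hX
  set Xm : Matrix (Fin 3) (Fin 3) ℝ := Matrix.of X with hXm
  set w : Fin 3 → ℝ := fun a => ℓ (v a) with hw
  -- (1) `ℓ([P_μ,P_ν]) = (C X Cᵀ) μ ν`
  have h1 : ∀ μ ν : NoiseIdx (fundamentalLatticeRep 2).N, ℓ ((fundamentalLatticeRep 2).lieProj (noiseDir μ) *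
      (fundamentalLatticeRep 2).lieProj (noiseDir ν) -
      (fundamentalLatticeRep 2).lieProj (noiseDir ν) * (fundamentalLatticeRep 2).lieProj (noiseDir μ)) =
      (Cm * Xm * Cmᵀ) μ ν := by
    intro μ ν
    have hexp : (fundamentalLatticeRep 2).lieProj (noiseDir μ) * (fundamentalLatticeRep 2).lieProj (noiseDir ν) -
        (fundamentalLatticeRep 2).lieProj (noiseDir ν) * (fundamentalLatticeRep 2).lieProj (noiseDir μ) =
        ∑ a : Fin 3, ∑ b : Fin 3, (((C μ a * C ν b : ℝ)) : ℂ) • (v a * v b - v b * v a) := by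
      have hA : (∑ a : Fin 3, ((C μ a : ℝ) : ℂ) • v a) * (∑ b : Fin 3, ((C ν b : ℝ) : ℂ) • v b) =
          ∑ a : Fin 3, ∑ b : Fin 3, (((C μ a * C ν b : ℝ)) : ℂ) • (v a * v b) := by
        rw [Finset.sum_mul_sum]
        refine Finset.sum_congr rfl fun a _ => Finset.sum_congr rfl fun b _ => ?_
        rw [smul_mul_smul_comm]
        push_cast
        rfl
      have hB : (∑ b : Fin 3, ((C ν b : ℝ) : ℂ) • v b) * (∑ a : Fin 3, ((C μ a : ℝ) : ℂ) • v a) =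
          ∑ a : Fin 3, ∑ b : Fin 3, (((C μ a * C ν b : ℝ)) : ℂ) • (v b * v a) := by
        rw [Finset.sum_mul_sum, Finset.sum_comm]
        refine Finset.sum_congr rfl fun a _ => Finset.sum_congr rfl fun b _ => ?_
        rw [smul_mul_smul_comm]
        push_cast
        rw [mul_comm ((C ν b : ℝ) : ℂ) ((C μ a : ℝ) : ℂ)]
      rw [hP μ, hP ν, hA, hB, ← Finset.sum_sub_distrib]
      refine Finset.sum_congr rfl fun a _ => ?_
      rw [← Finset.sum_sub_distrib]
      refine Finset.sum_congr rfl fun b _ => ?_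
      rw [smul_sub]
    rw [hexp, map_sum]
    simp_rw [map_sum, hℓ]
    rw [Matrix.mul_apply]
    simp_rw [Matrix.mul_apply, Matrix.transpose_apply, hCm, hXm, Matrix.of_apply, Finset.sum_mul]
    rw [Finset.sum_comm]
    refine Finset.sum_congr rfl fun b _ => Finset.sum_congr rfl fun a _ => ?_
    simp only [hX]
    ring
  -- (2) `ℓ(P_ν) = (C w) ν`
  have h2 : ∀ ν : NoiseIdx (fundamentalLatticeRep 2).N, ℓ ((fundamentalLatticeRep 2).lieProj (noiseDir ν)) = (Cm *ᵥ w) ν := by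
    intro ν
    rw [hP ν, map_sum, Matrix.mulVec, dotProduct]
    refine Finset.sum_congr rfl fun a _ => ?_
    rw [hℓ, hCm, Matrix.of_apply]
  simp_rw [h1, h2]
  -- (3) `Σ_{μν} (C X Cᵀ)_{μν}² = tr((CXCᵀ)(CXCᵀ)ᵀ) = ¼ tr(X Xᵀ)`
  have h3 : ∑ μ : NoiseIdx (fundamentalLatticeRep 2).N, ∑ ν : NoiseIdx (fundamentalLatticeRep 2).N,
      ((Cm * Xm * Cmᵀ) μ ν) ^ 2 = (1 / 4 : ℝ) * ∑ a, ∑ b, (X a b) ^ 2 := by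
    have hl : ∑ μ : NoiseIdx (fundamentalLatticeRep 2).N, ∑ ν : NoiseIdx (fundamentalLatticeRep 2).N,
        ((Cm * Xm * Cmᵀ) μ ν) ^ 2 =
        ((Cm * Xm * Cmᵀ) * (Cm * Xm * Cmᵀ)ᵀ).trace := by
      rw [Matrix.trace]
      refine Finset.sum_congr rfl fun μ _ => ?_
      rw [Matrix.diag_apply, Matrix.mul_apply]
      refine Finset.sum_congr rfl fun ν _ => ?_
      rw [Matrix.transpose_apply, sq]
    have hr : ∑ a, ∑ b, (X a b) ^ 2 = (Xm * Xmᵀ).trace := by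
      rw [Matrix.trace]
      refine Finset.sum_congr rfl fun a _ => ?_
      rw [Matrix.diag_apply, Matrix.mul_apply]
      refine Finset.sum_congr rfl fun b _ => ?_
      rw [Matrix.transpose_apply, hXm, Matrix.of_apply, sq]
    rw [hl, hr]
    have hT : (Cm * Xm * Cmᵀ)ᵀ = Cm * Xmᵀ * Cmᵀ := by
      rw [Matrix.transpose_mul, Matrix.transpose_mul, Matrix.transpose_transpose, Matrix.mul_assoc]
    rw [hT]
    calc (Cm * Xm * Cmᵀ * (Cm * Xmᵀ * Cmᵀ)).trace = (Cm * (Xm * Cmᵀ * Cm * Xmᵀ * Cmᵀ)).trace := by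
          simp only [Matrix.mul_assoc]
      _ = ((Xm * Cmᵀ * Cm * Xmᵀ * Cmᵀ) * Cm).trace := Matrix.trace_mul_comm _ _
      _ = (Xm * (Cmᵀ * Cm) * Xmᵀ * (Cmᵀ * Cm)).trace := by simp only [Matrix.mul_assoc]
      _ = ((1 / 4 : ℝ) • (Xm * Xmᵀ)).trace := by
          rw [hGram]
          simp only [Matrix.smul_mul, Matrix.mul_smul, Matrix.mul_one, smul_smul]
          norm_num
      _ = (1 / 4 : ℝ) * (Xm * Xmᵀ).trace := by rw [Matrix.trace_smul, smul_eq_mul]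
  -- (4) `Σ_ν (C w)_ν² = ½ Σ_a w_a²`
  have h4 : ∑ ν : NoiseIdx (fundamentalLatticeRep 2).N, ((Cm *ᵥ w) ν) ^ 2 = (1 / 2 : ℝ) * ∑ a, (w a) ^ 2 := by
    have hl : ∑ ν : NoiseIdx (fundamentalLatticeRep 2).N, ((Cm *ᵥ w) ν) ^ 2 = (Cm *ᵥ w) ⬝ᵥ (Cm *ᵥ w) := by
      rw [dotProduct]; refine Finset.sum_congr rfl fun ν _ => ?_; rw [sq]
    rw [hl, Matrix.dotProduct_mulVec, Matrix.vecMul_mulVec, hGram]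
    rw [dotProduct]
    simp only [Matrix.vecMul_smul, Matrix.vecMul_one, Pi.smul_apply, smul_eq_mul, Finset.mul_sum]
    refine Finset.sum_congr rfl fun a _ => ?_
    ring
  rw [h3, h4]
  -- (5) explicit brackets: `Σ_{ab} X_{ab}² = 8 Σ_c w_c²`
  obtain ⟨h01', h12', h20'⟩ := su2Dir_bracket
  have h01 : v 0 * v 1 - v 1 * v 0 = -(2 : ℂ) • v 2 := h01'
  have h12 : v 1 * v 2 - v 2 * v 1 = -(2 : ℂ) • v 0 := h12'
  have h20 : v 2 * v 0 - v 0 * v 2 = -(2 : ℂ) • v 1 := h20'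
  have hX00 : X 0 0 = 0 := by simp only [hX, sub_self, map_zero]
  have hX11 : X 1 1 = 0 := by simp only [hX, sub_self, map_zero]
  have hX22 : X 2 2 = 0 := by simp only [hX, sub_self, map_zero]
  have hneg : ∀ a b, X b a = -X a b := by
    intro a b; simp only [hX]; rw [← map_neg, neg_sub]
  have hX01 : X 0 1 = -2 * w 2 := by
    simp only [hX, hw]
    rw [h01, show (-(2 : ℂ)) = (((-2 : ℝ) : ℝ) : ℂ) by push_cast; ring, hℓ]
  have hX12 : X 1 2 = -2 * w 0 := by
    simp only [hX, hw]
    rw [h12, show (-(2 : ℂ)) = (((-2 : ℝ) : ℝ) : ℂ) by push_cast; ring, hℓ]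
  have hX20 : X 2 0 = -2 * w 1 := by
    simp only [hX, hw]
    rw [h20, show (-(2 : ℂ)) = (((-2 : ℝ) : ℝ) : ℂ) by push_cast; ring, hℓ]
  have hX10 : X 1 0 = 2 * w 2 := by rw [hneg, hX01]; ring
  have hX21 : X 2 1 = 2 * w 0 := by rw [hneg, hX12]; ring
  have hX02 : X 0 2 = 2 * w 1 := by rw [hneg, hX20]; ring
  simp only [Fin.sum_univ_three, hX00, hX11, hX22, hX01, hX12, hX20, hX10, hX21, hX02]
  ring

end Summit.QuantumFields.YangMills.Theorems.ColdStartUniversality
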